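import Summits.AtomisticToContinuum.FouriersLaw.Theorems.BondHeatUncertaintySubdiffusiveBondHeatThoulessBudgetLadderRungs

/-!
# The single-time budget ladder below `SubdiffusiveBondHeat` (9120): its floor is the residual `BoundedResponse` (11071)
# — FULL version (by-name discharges; imports the BondHeatUncertainty Theorems chain, hub-built 2026-09-01T02:33Z after the g52 KICK)

Decomposition node `decomp-a2c-lens-1 / g52` (grading lens), target item `stmt-AtomisticToContinuum-9120`
(`BondHeatUncertainty.SubdiffusiveBondHeat`, (S): `∃ A c>0 N₀ ∀ N ≥ N₀ ∃ b ∀ t ∈ [1, cN²], V_N(b,t) ≤ A√t`, the Edwards–Wilkinson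
¼-law of the equilibrium single-bond heat variance `V_N(b,t) = 2∫₀ᵗ(t−s)C_N(b,s)ds` up to the Thouless time).

OBSERVATION (read off the landed transfer `bddAbove_abs_of_transfer`, which sets `t := cN²` and never uses another time):
the route's cone consumes (S) only through ONE number per `N`, the THOULESS-TIME BUDGET `V_N(b,cN²) ≤ A√c·N`.  Both the
window quantifier `∀ t ∈ [1,cN²]` and the `√t` SHAPE are surplus.  Grading (S) by how much of it the cone uses:

* `ThoulessBudget`  (TB):  `∃ A c>0 N₀ ∀ N ≥ N₀ ∃ b, V_N(b,cN²) ≤ A·N`                       — one time, no shape;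
* `LateBudget`      (LB):  `∃ A c>0 N₀ ∀ N ≥ N₀ ∃ b ∃ t ≥ cN², V_N(b,t) ≤ A·t/N`              — any late time, Ohmic budget;

both typed over the VERBATIM `let P / C / V` of the item.  Kernel-checked seams (sorry-free):

1. `thoulessBudget_of_subdiffusiveBondHeat` : (S) → TB             (specialise `t = cN²`; `√(cN²) = √c·N`).
2. `lateBudget_of_thoulessBudget`           : TB → LB              (`t = cN²`, `A ↦ max A 0 / c`).
3. `boundedResponse_of_lateBudget`          : LB → (K) → (★) → NessUnique → BoundedResponse — the route's transfer works
   from LB ALONE: at a time `t ≥ cN²` with `V ≤ A t/N`, (★) `2G²t² ≤ V(Gt/T² + C N)` gives `2x² ≤ (A/T²)x + AC/c` for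
   `x = N·G_N` (`bddAbove_abs_of_lateBudget`); `NessUnique` (0741) is discharged by name (`nessUnique_proof`,
   `boundedResponse_of_lateBudget'`); (★) = item 9122 is CLOSED (`LinearResponseFTUR_proof`) and
   discharged by name here (`boundedResponse_of_lateBudget_of_snapshot : LB → (K) → BoundedResponse`).
4. `lateBudget_of_affineCeiling_of_ohmicFloor` : FixedNAffineBathBondCeiling → ContactOhmicFloor → LB — at the bath bond
   `b = 0`: a fixed-`N` affine ceiling `V_N(0,t) ≤ 4γT²E_N·t + B_N` (Ohm-free slope `E_N` = the boundary escape deficit;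
   = landed bath-bond reduction + fixed-`N` bounded transient `pinnedChain_transientIntegral_le_fixedN` + uniform statics
   `localEnergyMoment`) and the contact Ohmic floor `E_N ≤ C₁/N` (⟺ BoundedResponse, landed `boundedResponse_iff_ohmicFloor`);
   at `t = max(N², N·B_N⁺)`: `V_N(0,t) ≤ (4γT²C₁⁺ + 1)·t/N`.
   With `fixedNAffineBathBondCeiling_holds` and `ohmicFloor_of_boundedResponse` (both by name):
   `lateBudget_of_boundedResponse : BoundedResponse → LB`, UNCONDITIONALLY.
5. `lateBudget_iff_boundedResponse`         : (K) → (LB ↔ BoundedResponse)   — THE FLOOR OF THE LADDER IS THE RESIDUAL.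
6. `fouriersLaw_of_lateBudget`              : LB → (K) → [(★)] → ResponseLimitExists (24580) → ResponseEventuallyPositive
   (24581) → FouriersLaw (the sub-problem Statement, by name) through `ResponseFloorAndLimit.closes` with its three support
   items discharged by landed proofs — LB is ON the FouriersLaw cone.
7. `thoulessBudget_linearGrade_holds`       : the grade that IS a theorem — `∃ B ∀ N ≥ 2, V_N(0,N²) ≤ B·N²` (budget exponent 2,
   the landed `N`-uniform linear ceiling at the bath bond `bathBondHeatVar_le_linear`); through (★)+(K) it yields only the
   trivial `D_N = O(N)`.  Budget exponent `θ' ∈ (1,2)` (`V_N(b,cN²) ≤ A N^{θ'}`) yields `D_N = O(N^{θ'−1})`, i.e. only the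
   no-ballistic-channel half (`D_N/N → 0`, item 28286); `θ' = 1` (TB) is the first grade reaching BoundedResponse.

READING.  9120 = 11071 ⊕ TransientEW (window law of the Ohm-free transient, `subdiffusiveBondHeat_iff_boundedResponse`);
TB = 11071 ⊕ T₁ (the same transient at ONE time, `∫₀^{cN²}(1−θ_N−E_N) = O(N)`); LB = 11071 (mod (K)).  Every typable
weakening of 9120 that stays on the cone of `BondHeatUncertainty.closes` therefore still contains the residual 11071, and the
weakest of them is 11071 itself: nothing strictly below 9120 at depth 1 is easier than the residual, while the surplus of 9120
over the residual (the EW window law) can be cut to a single-time transient budget for free.  No item is closed here.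
-/

noncomputable section

open MeasureTheory Filter Topology Set
open Literature.MathematicalPhysics.KineticTheory.HeatConduction

namespace Summit.AtomisticToContinuum.FouriersLaw.Theorems.SubdiffusiveBondHeat.ThoulessBudgetLadder

open Summit.AtomisticToContinuum.FouriersLaw.Theses.BondHeatUncertainty
  (SubdiffusiveBondHeat ExtensiveSnapshotIrreversibility LinearResponseFTUR NessUnique BoundedResponse)
/-! ## Seam 4: (fixed-`N` affine ceiling) ∧ (contact Ohmic floor) ⟹ LB -/

/-- **H1 → H2 → LB.**  At `b = 0` and `t = max(N², N·B_N⁺)`:  `V_N(0,t) ≤ 4γT²E_N t + B_N ≤ 4γT²(C₁⁺/N)t + t/N`.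
[folklore] -/
theorem lateBudget_of_affineCeiling_of_ohmicFloor :
    FixedNAffineBathBondCeiling → ContactOhmicFloor → LateBudget := by
  intro hA hfl ω₂ lam β γ hω hl hβ hγ T hT P C V
  obtain ⟨C₁, N₀, hflN⟩ := hfl ω₂ lam β γ hω hl hβ hγ T hT
  refine ⟨4 * γ * T ^ 2 * max C₁ 0 + 1, 1, one_pos, max N₀ 2, fun N hN => ?_⟩
  have hN₀ : N₀ ≤ N := le_trans (le_max_left _ _) hN
  have hN2 : 2 ≤ N := le_trans (le_max_right _ _) hN
  have hN1 : 1 < N := by omega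
  have hNpos : (0 : ℝ) < N := by exact_mod_cast (show 0 < N by omega)
  refine ⟨0, by omega, ?_⟩
  obtain ⟨BN, hBN⟩ := hA ω₂ lam β γ hω hl hβ hγ T hT N hN1
  set t : ℝ := max (1 * (N : ℝ) ^ 2) ((N : ℝ) * max BN 0) with ht
  have ht0 : 0 ≤ t := le_trans (by positivity) (le_max_left _ _)
  refine ⟨t, le_max_left _ _, ?_⟩
  -- the Ohmic floor in H1's spelling
  have hE : 1 - γ / T ^ 2 * (∫ u in Set.Ioi (0 : ℝ),
      ∫ z, ((z.2 ⟨0, Nat.zero_lt_of_lt hN1⟩) ^ 2 - T) *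
          (∫ y, ((y.2 ⟨0, Nat.zero_lt_of_lt hN1⟩) ^ 2 - T)
            ∂((pinnedChain ω₂ lam β γ).transitionKernel N T T u.toNNReal z))
        ∂((pinnedChain ω₂ lam β γ).gibbsMeasure N T)) ≤ max C₁ 0 / (N : ℝ) := by
    have h := hflN N hN₀
    simp only [dif_pos (Nat.zero_lt_of_lt hN1)] at h
    exact h.trans (div_le_div_of_nonneg_right (le_max_left _ _) hNpos.le)
  have key := hBN t ht0
  have hγT : 0 ≤ 4 * γ * T ^ 2 := by positivity
  -- absorb B_N: B_N ≤ (N · B_N⁺)/N ≤ t/N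
  have hBt : BN ≤ t / (N : ℝ) := by
    have h1 : BN ≤ max BN 0 := le_max_left _ _
    have h2 : max BN 0 = (N : ℝ) * max BN 0 / (N : ℝ) := by field_simp
    rw [h2] at h1
    exact h1.trans (div_le_div_of_nonneg_right (le_max_right _ _) hNpos.le)
  simp only [V, C, dif_pos (Nat.zero_lt_of_lt hN1)]
  calc _ ≤ _ := key
    _ ≤ 4 * γ * T ^ 2 * (max C₁ 0 / (N : ℝ)) * t + t / (N : ℝ) := by
        nlinarith [mul_le_mul_of_nonneg_left (mul_le_mul_of_nonneg_right hE ht0) hγT]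
    _ = (4 * γ * T ^ 2 * max C₁ 0 + 1) * t / (N : ℝ) := by ring

/-- **H1 holds** (by name from the tree): bath-bond reduction `V_N(0,t) ≤ 4γT²W_N(t) + 8E[e₀²]`, `W_N(t) = ∫₀ᵗ(1−θ_N) =
∫₀ᵗ(1−θ_N−E_N) + tE_N` with the fixed-`N` transient bound `∫₀ᵗ(1−θ_N−E_N) ≤ B'_N` and `E[e₀²] ≤ σ²`. [folklore] -/
theorem fixedNAffineBathBondCeiling_holds : FixedNAffineBathBondCeiling := by
  intro ω₂ lam β γ hω hl hβ hγ T hT N hN1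
  obtain ⟨σ2, hσ⟩ := localEnergyMoment ω₂ lam β γ hω hl hβ hγ T hT
  obtain ⟨BN, hBN⟩ := pinnedChain_transientIntegral_le_fixedN hω hl hβ hγ (Nat.zero_lt_of_lt hN1) hT
  refine ⟨4 * γ * T ^ 2 * BN + 8 * σ2, fun t ht0 => ?_⟩
  have hred := stub_bathBondReduction_of_kernelFacts ω₂ lam β γ hω hl hβ hγ T hT N hN1
    (stub_kernelDetailedBalance ω₂ lam β γ hω hl hβ hγ T hT N hN1)
    (stub_siteEnergyDynkin ω₂ lam β γ hω hl hβ hγ T hT N hN1)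
    (stub_siteEnergyCurrentCovariance ω₂ lam β γ hω hl hβ hγ T hT N hN1) t ht0
  have hmom := hσ N hN1
  have hBNt := hBN t ht0
  simp only [dif_pos (Nat.zero_lt_of_lt hN1)] at hBNt
  have hθc := pinnedChain_continuous_stepResponse hω hl hβ hγ hT (Nat.zero_lt_of_lt hN1)
  -- name the boundary kernel
  set K : ℝ → ℝ := fun u => ∫ z, ((z.2 ⟨0, Nat.zero_lt_of_lt hN1⟩) ^ 2 - T) *
      (∫ y, ((y.2 ⟨0, Nat.zero_lt_of_lt hN1⟩) ^ 2 - T)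
        ∂((pinnedChain ω₂ lam β γ).transitionKernel N T T u.toNNReal z))
    ∂((pinnedChain ω₂ lam β γ).gibbsMeasure N T) with hK
  set E : ℝ := 1 - γ / T ^ 2 * ∫ u in Set.Ioi (0 : ℝ), K u with hE
  -- W_N(t) = transient integral + t·E_N
  have hfi : IntervalIntegrable (fun s : ℝ => 1 - γ / T ^ 2 * ∫ u in (0 : ℝ)..s, K u) volume 0 t :=
    (continuous_const.sub hθc).intervalIntegrable 0 t
  have hW : ∫ s in (0 : ℝ)..t, (1 - γ / T ^ 2 * ∫ u in (0 : ℝ)..s, K u) =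
      (∫ s in (0 : ℝ)..t, ((1 - γ / T ^ 2 * ∫ u in (0 : ℝ)..s, K u) - E)) + t * E := by
    rw [intervalIntegral.integral_sub hfi intervalIntegrable_const, intervalIntegral.integral_const, smul_eq_mul,
      sub_zero]
    ring
  have hWle : ∫ s in (0 : ℝ)..t, (1 - γ / T ^ 2 * ∫ u in (0 : ℝ)..s, K u) ≤ BN + t * E := by
    rw [hW]; linarith
  have hγT : 0 ≤ 4 * γ * T ^ 2 := by positivity
  calc _ ≤ _ := hred
    _ ≤ 4 * γ * T ^ 2 * (BN + t * E) + 8 * σ2 := by nlinarith [mul_le_mul_of_nonneg_left hWle hγT]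
    _ = 4 * γ * T ^ 2 * E * t + (4 * γ * T ^ 2 * BN + 8 * σ2) := by ring

/-- **BoundedResponse ⟹ LB, UNCONDITIONALLY** (H1 by `fixedNAffineBathBondCeiling_holds`, H2 by the landed
`ohmicFloor_of_boundedResponse`). [folklore] -/
theorem lateBudget_of_boundedResponse : BoundedResponse → LateBudget := fun hB =>
  lateBudget_of_affineCeiling_of_ohmicFloor fixedNAffineBathBondCeiling_holds (ohmicFloor_of_boundedResponse hB)

/-! ## Seam 5: the floor of the ladder is the residual -/

/-- **(K) → (LateBudget ↔ BoundedResponse).**  Modulo the route's other crux (K) (`ExtensiveSnapshotIrreversibility`, 9121,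
used only left-to-right), the weakest single-time weakening of 9120 IS the shared residual `BoundedResponse` (11071).
[folklore] -/
theorem lateBudget_iff_boundedResponse (hK : ExtensiveSnapshotIrreversibility) :
    LateBudget ↔ BoundedResponse :=
  ⟨fun hL => boundedResponse_of_lateBudget_of_snapshot hL hK, lateBudget_of_boundedResponse⟩

/-- Hence **TB ⟹ (K) ⟹ BoundedResponse** (and (S) ⟹ (K) ⟹ BoundedResponse factors through LB). -/
theorem boundedResponse_of_thoulessBudget_of_snapshot :
    ThoulessBudget → ExtensiveSnapshotIrreversibility → BoundedResponse := fun hTB hK =>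
  boundedResponse_of_lateBudget_of_snapshot (lateBudget_of_thoulessBudget hTB) hK

/-! ## Seam 6: LB is on the FouriersLaw cone (through route `ResponseFloorAndLimit`) -/

/-- `BondHeatUncertainty.BoundedResponse` (11071, unconditional along every steady-state family) gives the conditional
spelling `ResponseFloorAndLimit.BoundedResponse` (10924, the same under weak-NESS uniqueness) by discarding the
uniqueness hypothesis. -/
theorem responseFloorAndLimit_boundedResponse_of (hB : BoundedResponse) :
    Summit.AtomisticToContinuum.FouriersLaw.Theses.ResponseFloorAndLimit.BoundedResponse :=
  fun ω₂ lam β γ hω hl hβ hγ _ => hB ω₂ lam β γ hω hl hβ hγ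

/-- **BoundedResponse → ResponseLimitExists (24580) → ResponseEventuallyPositive (24581) → FouriersLaw** (the sub-problem
Statement decl, by name): `ResponseFloorAndLimit.closes` with `NessUnique`, `PinnedSteadyStateExists`,
`FiniteResponseOfUnique` discharged by landed proofs. [folklore] -/
theorem fouriersLaw_of_boundedResponse (hB : BoundedResponse)
    (hLim : Summit.AtomisticToContinuum.FouriersLaw.Theses.ResponseFloorAndLimit.ResponseLimitExists)
    (hPos : Summit.AtomisticToContinuum.FouriersLaw.Theses.ResponseFloorAndLimit.ResponseEventuallyPositive) :
    _root_.FouriersLaw :=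
  Summit.AtomisticToContinuum.FouriersLaw.Theses.ResponseFloorAndLimit.closes
    Summit.AtomisticToContinuum.FouriersLaw.Theorems.nessUnique_proof
    (fun _ _ _ _ hω hl hβ hγ N _ _ h1 h2 => pinnedChain_exists_isSteadyState hω hl hβ hγ N h1 h2)
    Summit.AtomisticToContinuum.FouriersLaw.Theorems.FourierGreenKubo.finiteResponseOfUnique_holds
    (responseFloorAndLimit_boundedResponse_of hB) hLim hPos

/-- **LB → (K) → ResponseLimitExists → ResponseEventuallyPositive → FouriersLaw.** [folklore] -/
theorem fouriersLaw_of_lateBudget (hL : LateBudget) (hK : ExtensiveSnapshotIrreversibility)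
    (hLim : Summit.AtomisticToContinuum.FouriersLaw.Theses.ResponseFloorAndLimit.ResponseLimitExists)
    (hPos : Summit.AtomisticToContinuum.FouriersLaw.Theses.ResponseFloorAndLimit.ResponseEventuallyPositive) :
    _root_.FouriersLaw :=
  fouriersLaw_of_boundedResponse (boundedResponse_of_lateBudget_of_snapshot hL hK) hLim hPos

/-- The same from TB. -/
theorem fouriersLaw_of_thoulessBudget (hTB : ThoulessBudget) (hK : ExtensiveSnapshotIrreversibility)
    (hLim : Summit.AtomisticToContinuum.FouriersLaw.Theses.ResponseFloorAndLimit.ResponseLimitExists)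
    (hPos : Summit.AtomisticToContinuum.FouriersLaw.Theses.ResponseFloorAndLimit.ResponseEventuallyPositive) :
    _root_.FouriersLaw :=
  fouriersLaw_of_lateBudget (lateBudget_of_thoulessBudget hTB) hK hLim hPos

/-- And from 9120 itself along this file's seams ((S) → TB → LB → BR → FouriersLaw given (K), 24580, 24581). -/
theorem fouriersLaw_of_subdiffusiveBondHeat (hS : SubdiffusiveBondHeat) (hK : ExtensiveSnapshotIrreversibility)
    (hLim : Summit.AtomisticToContinuum.FouriersLaw.Theses.ResponseFloorAndLimit.ResponseLimitExists)
    (hPos : Summit.AtomisticToContinuum.FouriersLaw.Theses.ResponseFloorAndLimit.ResponseEventuallyPositive) :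
    _root_.FouriersLaw :=
  fouriersLaw_of_thoulessBudget (thoulessBudget_of_subdiffusiveBondHeat hS) hK hLim hPos

/-! ## Seam 7: where the theorems stop on the budget ladder -/

/-- **The linear grade is a theorem**: `∃ B ∀ N ≥ 2, V_N(0, N²) ≤ B·N²` — budget exponent `2` at the Thouless time,
unconditionally and uniformly in `N`, from the landed all-times linear ceiling at the bath bond `bathBondHeatVar_le_linear`
(reservoir energy balance + uniform statics).  Through (★)+(K) this grade returns only the trivial `D_N = O(N)`; every
budget exponent `< 2` is open, and `1` (TB) is the first that reaches `BoundedResponse`. [folklore] -/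
theorem thoulessBudget_linearGrade_holds :
    ∀ ω₂ lam β γ : ℝ, 0 < ω₂ → 0 < lam → 0 < β → 0 < γ → ∀ T : ℝ, 0 < T →
      (let P := pinnedChain ω₂ lam β γ
       let C : ℕ → ℕ → ℝ → ℝ := fun N b s => if h : b < N then ∫ z, P.bondCurrent N ⟨b, h⟩ z *
         (∫ y, P.bondCurrent N ⟨b, h⟩ y ∂(P.transitionKernel N T T s.toNNReal z)) ∂(P.gibbsMeasure N T) else 0
       let V : ℕ → ℕ → ℝ → ℝ := fun N b t => 2 * ∫ s in (0 : ℝ)..t, (t - s) * C N b s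
       ∃ B : ℝ, ∀ N : ℕ, 2 ≤ N → V N 0 ((N : ℝ) ^ 2) ≤ B * (N : ℝ) ^ 2) := by
  intro ω₂ lam β γ hω hl hβ hγ T hT P C V
  obtain ⟨B, hB⟩ := bathBondHeatVar_le_linear ω₂ lam β γ hω hl hβ hγ T hT
  refine ⟨B, fun N hN => ?_⟩
  have hN1 : (1 : ℝ) ≤ (N : ℝ) ^ 2 := by
    have : (2 : ℝ) ≤ N := by exact_mod_cast hN
    nlinarith
  exact hB N hN ((N : ℝ) ^ 2) hN1

end Summit.AtomisticToContinuum.FouriersLaw.Theorems.SubdiffusiveBondHeat.ThoulessBudgetLadder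

end
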